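import Summits.BirchSwinnertonDyer.Rank1Residual.X11b.BDPRouteOddPrimeClass
import Summits.BirchSwinnertonDyer.Rank1Residual.X11b.SelmerRankOne
import HarnessLib

/-!
# Class X11b on the atom A1 (`(ram) ∧ p ∤ ∏c_ℓ`), EVERY ODD PRIME, `p^j ∣ #Ш_an` rows: `BSD(E,p)`
# from the UNCONDITIONAL Euler-system half and ONE exact `p`-descent certificate — no Heegner-index
# certificate, no partner curve, no Cassels–Tate (cell `b2b-bsdres`, team `x11b3` = N8/O2, seat p5)

HONEST FRAMING (cell `b2b-bsdres`, run/shared/lean/b2b/bsd-rank1-residual/, verbatim in every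
file): the goal of the cell is to DELETE the COMBINATION-SHAPED residual classes of the
Birch–Swinnerton-Dyer formula for ALL analytic-rank `≤ 1` elliptic curves over `ℚ` — "full BSD
formula for every rank `≤ 1` curve in class `C`" assembled STRICTLY from published theorems — so
that the rank-`≤ 1` remainder becomes exactly the CONSTRUCTION-SHAPED classes, which are TYPED
(missing-input `Prop`s), NOT attempted. This is not "finishing BSD". Team `x11b3` (X11b, STEP L at
`3 ∥ N`) is a RESEARCH team; no claim beyond the stated class and atom; X11b and X11 ∧ `r = 1` ∧
`p = 3` stay CONSTRUCTION-SHAPED; nothing here is booked (the lane books); census numbers quoted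
below are EVIDENCE pointers, never inputs. THEOREMS ONLY (no definition, no named fact, no `sorry`).

## What this file does

Two tree theorems are composed, nothing else:

* the **Euler-system half on the atom A1, every odd prime, UNCONDITIONAL** (sub-cell `multr1-p2`,
  `BDPRouteOddPrimeClass.lean`): `missingUpperBoundAt_of_classX11b_of_ram_of_not_dvd` — for every
  `(E,p)` in X11b (`r_an = 1`, `p` odd, multiplicative at `p`, `E[p]` irreducible) with a (ram) prime
  and `p ∤ ∏_ℓ c_ℓ(E)`: `ord_p #Ш(E) ≤ ord_p #Ш(E)_an`, from ten PUBLISHED named facts (Gross–Zagier,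
  Kolyvagin 1990 Thm. A + McCallum's index bound, Skinner 2016 Thm. C for the Hoffstein–Luo twist —
  `p ≥ 3`, footnote 1 —, GZK, modularity ×2, Hoffstein–Luo 1997, Mazur 1978 Cor. 4.1, the Néron
  mapping property). NO Heegner-index valuation enters: the index is eliminated by the Gross–Zagier
  bookkeeping against `#Ш(E^{d_K})_an = #Ш(E^{d_K})` (Skinner) — Kolyvagin's "Tamagawa defect" is
  `2·ord_p ∏c_ℓ = 0` on the atom;
* the **exact `p`-descent count as a LOWER certificate** (unit `x11b` gen 9, `SelmerRankOne.lean`):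
  `pow_dvd_shaOrder_of_card_selmerGroup` — `#Sel^(p)(E/ℚ) = p^(rank + j)` and `E(ℚ)[p] = 0`
  (automatic: `E[p]` irreducible, Mazur) give `p^j ∣ #Ш(E/ℚ)`.

Hence (§2) **`bsdp_of_classX11b_of_ram_of_not_dvd_of_pow_dvd`**: on X11b ∧ (ram) ∧ `p ∤ ∏c_ℓ`, if
`p^j ∣ #Ш(E)` (any certificate: exact descent, visibility, Cassels–Tate, …) and `ord_p #Ш(E)_an ≤ j`,
then `BSD(E,p)`; (§2) **`bsdp_of_classX11b_of_ram_of_not_dvd_of_card_selmer`**: the same with the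
certificate `#Sel^(p)(E/ℚ) = p^(1+j)`; (§3) the `p = 3` rows in the vocabulary of `IsX11Three`
(`Rank1Residual/X11Three.lean`) and of `ClassX11 W 3`, in particular the `#Ш_an = 9` / `#Sel₃ = 27`
shape **`IsX11Three.bsdp_of_ram_of_not_dvd_of_card_selmerThree_eq`** /
**`X11.bsdp_three_of_ram_of_not_dvd_of_card_selmerThree`**. The case `j = 0` is the sibling's
`bsdp_of_classX11b_of_ram_of_padicValRat_shaAn_le` (no certificate at all).

## Why (numbers, not adjectives — EVIDENCE pointers, lane data, nothing booked here)

The x11b gen-9 closing table (`HOME/b2b-bsdres-x11b/sel3x5e5/CLOSING_x11b3_5e5.tsv`) and rmap-3 g5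
(`HOME/b2b-bsdres-rmap-3/g5/x11b3left/x11b3_left.tsv`, RESIDUAL-MAP §H ⟦g5⟧, CLASS-CLOSURE-PLAN §3.10)
list, among the lane's X11b@3 rank-one residue classes at `N < 5·10⁵`, **46 classes with `#Ш_an = 9`
and an EXACT `#Sel₃ = 27` certificate (LB3)**, read so far ONLY through the per-pair route
`ClassX11b.bsdp_of_kolyvagin_of_card_selmer` (UPPER half = a Heegner field with `ord₃ [E(K):ℤy_K] ≤ 1`):
39 "CLOSABLE:LB3+KOLY" and **7 "OPEN: no upper half"** (every Heegner field of record has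
`ord₃ I_K = 2`). On the atom A1 = (ram) ∧ `3 ∤ ∏c_ℓ` the upper half needs NO index: this file's
`p = 3` rows read the two A1 classes among the seven — **`397848o1`, `443400c1`** (atom A1, `surj(3)`,
`#Ш_an = 9`, LB3 in hand) — as closable by published theorems + the ONE certificate already held, and
drop the index certificate from the A1 rows among the 39. The five (T2′) classes (`3 ∣ ∏c_ℓ`:
`191424ce1, 318828a1, 368358k1, 463488bg1, 498525ca1`) are NOT reached (Kolyvagin's Tamagawa defect
`2·ord₃ ∏c_ℓ ≥ 2` there; a Jetchev-type bound at `p ∣ N` or a Cassels–Tate certificate on `Ш[3]` is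
what they need — team x11b3's ideation targets). Per pair / sub-class statements; NOT a class
deletion; the lane certifies and books.

References: [JetchevSkinnerWan2017] §7.4.2 (p. 31); [McCallumLMS1991] §1; [GrossLMS1991] Thm. 1.3;
[Skinner2016PacificMC] Thm. C and footnote 1; [HoffsteinLuo1997] Theorem (§1); [Mazur1978] Cor. 4.1;
[Mazur1977] III.§5; [SilvermanAEC2009] X.4.2; [SchaeferStoll2004] §1; [Miller2011LMS] Def. 1.1;
cell files `X11b/BDPRouteOddPrimeClass.lean`, `X11b/SelmerRankOne.lean`.
-/

noncomputable section

open scoped Classical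

open WeierstrassCurve NumberField Literature.NumberTheory.EllipticCurves
  Literature.NumberTheory.EllipticCurves.ModularForms
  Literature.NumberTheory.EllipticCurves.Rank1Residual
  Literature.NumberTheory.EllipticCurves.Rank1Residual.Typed

namespace Summit.BirchSwinnertonDyer.Rank1Residual.X11b

/-! ### §1. The LOWER half from a divisibility certificate `p^j ∣ #Ш(E)` (bookkeeping) -/

section Lower

variable (W : WeierstrassCurve ℚ) (p : ℕ) [Fact p.Prime]

/-- **The typed LOWER half** (`MissingLowerBoundAt`: `ord_p #Ш_an ≤ ord_p #Ш`) at a pair with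
`#Ш_an = s`, `ord_p s ≤ j`, from a divisibility certificate `p^j ∣ #Ш(E/ℚ)` and `Ш(E/ℚ)` finite
(`missingLowerBoundAt_of_sq_dvd` of `SelmerRankOne.lean` is `j = 2`). Bookkeeping; how the
divisibility is certified (exact `p`-descent, visibility, Cassels–Tate) is lane business.
[cite: Miller2011LMS, Def. 1.1 (arXiv:1010.2431 p. 3)] -/
theorem missingLowerBoundAt_of_pow_dvd (hfin : W.ShaFinite) {s : ℚ} (hs : shaAn W = (s : ℂ))
    {j : ℕ} (hv : padicValRat p s ≤ j) (hdvd : p ^ j ∣ W.shaOrder) : MissingLowerBoundAt W p := by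
  have hn : W.shaOrder ≠ 0 := (WeierstrassCurve.shaOrder_pos W hfin).ne'
  have hle : j ≤ padicValNat p W.shaOrder := (padicValNat_dvd_iff_le hn).mp hdvd
  exact ⟨s, hs, hv.trans (by exact_mod_cast hle)⟩

end Lower

/-! ### §2. Class X11b on the atom A1, every odd prime: published facts + ONE lower certificate -/

section AtomA1

/-- **X11b ∧ (ram) ∧ `p ∤ ∏c_ℓ`, EVERY ODD PRIME: `BSD(E,p)` from PUBLISHED theorems plus ONE
divisibility certificate `p^j ∣ #Ш(E/ℚ)` with `ord_p #Ш(E)_an ≤ j`.** UPPER half: the sibling's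
UNCONDITIONAL `missingUpperBoundAt_of_classX11b_of_ram_of_not_dvd` (Kolyvagin 1990 Thm. A at the
Hoffstein–Luo / Manin-good Heegner datum, Gross–Zagier bookkeeping against Skinner 2016 Thm. C for the
rank-zero twist — ten published named facts `hGZ hKo hB hSk hGZK hmod hnf hHL hMaz hNS`; NO
Heegner-index valuation). LOWER half: `missingLowerBoundAt_of_pow_dvd` (`Ш(E/ℚ)` finite by GZK). Then
`bsdp_of_halves`. The case `j = 0` is `bsdp_of_classX11b_of_ram_of_padicValRat_shaAn_le`. Sub-class
statement with a per-pair certificate; NOT a class deletion; nothing booked.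
[cite: JetchevSkinnerWan2017, §7.4.2 (p. 31)] [cite: McCallumLMS1991, §1 Theorem (Kolyvagin), p. 296]
[cite: Skinner2016PacificMC, Thm. C (§1) and footnote 1] [cite: HoffsteinLuo1997, Theorem (§1)]
[cite: Mazur1978, Cor. 4.1] [cite: Miller2011LMS, §1 and Def. 1.1] -/
theorem bsdp_of_classX11b_of_ram_of_not_dvd_of_pow_dvd
    -- published inputs (named facts of the tree)
    (hGZ : ∀ (N : ℕ) [NeZero N] (W : WeierstrassCurve ℚ) (K : Type) [Field K] [NumberField K],
      gross_zagier N W K)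
    (hKo : ∀ (N : ℕ) [NeZero N] (W : WeierstrassCurve ℚ) (K : Type) [Field K] [NumberField K],
      kolyvagin N W K)
    (hB : ∀ (N : ℕ) [NeZero N] (W : WeierstrassCurve ℚ) (K : Type) [Field K] [NumberField K],
      Kolyvagin1990_padicValNat_card_sha_le N W K)
    (hSk : Skinner2016.thmC_padicValRat_bsd_rank_zero)
    (hGZK : rank_eq_analyticRank_of_analyticRank_le_one) (hmod : hasEntireLFunction_rat)
    (hnf : exists_isNewformOf) (hHL : HoffsteinLuo1997_exists_twist_L_one_ne_zero)
    (hMaz : mazur_not_dvd_maninConstant_of_odd) (hNS : integral_neronScaling_of_isGloballyMinimal)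
    -- the pair, on the atom A1
    (W : WeierstrassCurve ℚ) [W.IsElliptic] [W.IsGloballyMinimal] (p : ℕ) [Fact p.Prime]
    (hX : ClassX11b W p) (hram : Ram W p) (htam0 : ¬ p ∣ W.tamagawaProduct)
    -- the certificates: `p^j ∣ #Ш(E/ℚ)` and `#Ш_an = s` with `ord_p s ≤ j`
    {j : ℕ} (hdvd : p ^ j ∣ W.shaOrder) {s : ℚ} (hs : shaAn W = (s : ℂ))
    (hv : padicValRat p s ≤ j) : BSDp W p := by
  have hr : W.analyticRank ≤ 1 := le_of_eq hX.1
  have hfin : W.ShaFinite := (hGZK W hr).2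
  exact bsdp_of_halves hGZK W p hr (missingLowerBoundAt_of_pow_dvd W p hfin hs hv hdvd)
    (missingUpperBoundAt_of_classX11b_of_ram_of_not_dvd hGZ hKo hB hSk hGZK hmod hnf hHL hMaz hNS W p
      hX hram htam0)

/-- **X11b ∧ (ram) ∧ `p ∤ ∏c_ℓ`, EVERY ODD PRIME: `BSD(E,p)` from PUBLISHED theorems plus ONE EXACT
`p`-DESCENT CERTIFICATE `#Sel^(p)(E/ℚ) = p^(1+j)` with `ord_p #Ш(E)_an ≤ j`.** The lower certificate of
`bsdp_of_classX11b_of_ram_of_not_dvd_of_pow_dvd` is produced from the Selmer count by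
`pow_dvd_shaOrder_of_card_selmerGroup` (`rank E(ℚ) = r_an = 1` by GZK; `E(ℚ)[p] = 0` because `E[p]`
is irreducible, Mazur): `Ш(E/ℚ)[p] ≅ (ℤ/p)^j`, so `p^j ∣ #Ш(E/ℚ)`. NO Heegner-index certificate, NO
partner curve, NO Cassels–Tate — contrast `ClassX11b.bsdp_of_kolyvagin_of_card_selmer` (index `≤ 1`
needed, any Tamagawa numbers). Sub-class statement with a per-pair certificate; nothing booked.
[cite: McCallumLMS1991, §1 Theorem (Kolyvagin), p. 296] [cite: Skinner2016PacificMC, Thm. C (§1) and footnote 1]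
[cite: SilvermanAEC2009, Thm. X.4.2(a)] [cite: SchaeferStoll2004, §1] [cite: Mazur1977, Ch. III §5, p. 157]
[cite: Miller2011LMS, §1 and Def. 1.1] -/
theorem bsdp_of_classX11b_of_ram_of_not_dvd_of_card_selmer
    -- published inputs (named facts of the tree)
    (hGZ : ∀ (N : ℕ) [NeZero N] (W : WeierstrassCurve ℚ) (K : Type) [Field K] [NumberField K],
      gross_zagier N W K)
    (hKo : ∀ (N : ℕ) [NeZero N] (W : WeierstrassCurve ℚ) (K : Type) [Field K] [NumberField K],
      kolyvagin N W K)
    (hB : ∀ (N : ℕ) [NeZero N] (W : WeierstrassCurve ℚ) (K : Type) [Field K] [NumberField K],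
      Kolyvagin1990_padicValNat_card_sha_le N W K)
    (hSk : Skinner2016.thmC_padicValRat_bsd_rank_zero)
    (hGZK : rank_eq_analyticRank_of_analyticRank_le_one) (hmod : hasEntireLFunction_rat)
    (hnf : exists_isNewformOf) (hHL : HoffsteinLuo1997_exists_twist_L_one_ne_zero)
    (hMaz : mazur_not_dvd_maninConstant_of_odd) (hNS : integral_neronScaling_of_isGloballyMinimal)
    -- the pair, on the atom A1
    (W : WeierstrassCurve ℚ) [W.IsElliptic] [W.IsGloballyMinimal] (p : ℕ) [Fact p.Prime]
    (hX : ClassX11b W p) (hram : Ram W p) (htam0 : ¬ p ∣ W.tamagawaProduct)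
    -- the certificates: the exact `p`-descent count and `#Ш_an = s` with `ord_p s ≤ j`
    {j : ℕ} (hcard : Nat.card (W.selmerGroup (p : ℤ)) = p ^ (1 + j)) {s : ℚ}
    (hs : shaAn W = (s : ℂ)) (hv : padicValRat p s ≤ j) : BSDp W p := by
  obtain ⟨hrk, -⟩ := hGZK W (le_of_eq hX.1)
  have hirr : Irr W p := hX.2.2.2
  -- LOWER certificate `p^j ∣ #Ш(E/ℚ)` from the Selmer count (no rational `p`-torsion: Mazur)
  have hdvd : p ^ j ∣ W.shaOrder :=
    pow_dvd_shaOrder_of_card_selmerGroup W p (j := j) (by rw [hrk, hX.1]; exact hcard)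
      ((natCard_torsionBy_point_eq_of_subsingleton W _ _ _).trans
        (natCard_torsionBy_eq_one_of_hasIrreducibleModPGaloisRep W p hirr))
  exact bsdp_of_classX11b_of_ram_of_not_dvd_of_pow_dvd hGZ hKo hB hSk hGZK hmod hnf hHL hMaz hNS W p hX
    hram htam0 hdvd hs hv

end AtomA1

/-! ### §3. The `p = 3` rows (`IsX11Three` / `ClassX11 W 3`): the `#Ш_an = 9`, `#Sel₃ = 27` shape -/

section Three

/-- **X11 at `p = 3`, rank one (`IsX11Three`), with a (ram) prime and `3 ∤ ∏c_ℓ(E)`: `BSD(E,3)` from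
PUBLISHED theorems plus ONE EXACT `3`-DESCENT CERTIFICATE `#Sel^(3)(E/ℚ) = 3^(1+j)` with
`ord_3 #Ш(E)_an ≤ j`** (`bsdp_of_classX11b_of_ram_of_not_dvd_of_card_selmer` at `p = 3`; Kolyvagin at
`p = 3` with `ρ̄_{E,3}` onto from irr(3) + ram(3), Skinner 2016 Thm. C at `p = 3` for the twist —
footnote 1). `j = 0` (`#Sel₃ = 3`, `3 ∤ #Ш_an`) is the T-SEL3 shape, also covered class-free by
`Typed.X11.bsdp_three_of_card_selmerThree_pow`; `j = 2` is the LB3 shape below. Per pair; X11 ∧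
`r = 1` ∧ `p = 3` stays CONSTRUCTION-SHAPED (REFEREE R6.2); nothing booked.
[cite: McCallumLMS1991, §1 Theorem (Kolyvagin), p. 296] [cite: Skinner2016PacificMC, Thm. C (§1) and footnote 1]
[cite: SilvermanAEC2009, Thm. X.4.2(a)] [cite: Miller2011LMS, §1 and Def. 1.1] -/
theorem IsX11Three.bsdp_of_ram_of_not_dvd_of_card_selmerThree
    -- published inputs (named facts of the tree)
    (hGZ : ∀ (N : ℕ) [NeZero N] (W : WeierstrassCurve ℚ) (K : Type) [Field K] [NumberField K],
      gross_zagier N W K)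
    (hKo : ∀ (N : ℕ) [NeZero N] (W : WeierstrassCurve ℚ) (K : Type) [Field K] [NumberField K],
      kolyvagin N W K)
    (hB : ∀ (N : ℕ) [NeZero N] (W : WeierstrassCurve ℚ) (K : Type) [Field K] [NumberField K],
      Kolyvagin1990_padicValNat_card_sha_le N W K)
    (hSk : Skinner2016.thmC_padicValRat_bsd_rank_zero)
    (hGZK : rank_eq_analyticRank_of_analyticRank_le_one) (hmod : hasEntireLFunction_rat)
    (hnf : exists_isNewformOf) (hHL : HoffsteinLuo1997_exists_twist_L_one_ne_zero)
    (hMaz : mazur_not_dvd_maninConstant_of_odd) (hNS : integral_neronScaling_of_isGloballyMinimal)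
    -- the pair, on the atom A1 at `p = 3`
    (W : WeierstrassCurve ℚ) [W.IsElliptic] [W.IsGloballyMinimal] (hX : IsX11Three W)
    (hram : Ram W 3) (htam0 : ¬ 3 ∣ W.tamagawaProduct)
    -- the certificates
    {j : ℕ} (hcard : Nat.card (W.selmerGroup (3 : ℤ)) = 3 ^ (1 + j)) {s : ℚ}
    (hs : shaAn W = (s : ℂ)) (hv : padicValRat 3 s ≤ j) : BSDp W 3 :=
  bsdp_of_classX11b_of_ram_of_not_dvd_of_card_selmer hGZ hKo hB hSk hGZK hmod hnf hHL hMaz hNS W 3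
    (classX11b_three_of_isX11Three W hX) hram htam0 (j := j)
    (by rw [show ((3 : ℕ) : ℤ) = 3 by norm_num]; exact hcard) hs hv

/-- **The LB3 rows on the atom A1 at `p = 3`: `#Sel^(3)(E/ℚ) = 27` and `ord_3 #Ш(E)_an ≤ 2` ⇒
`BSD(E,3)`** for `E` of analytic rank one, multiplicative at `3`, `E[3]` irreducible, with a (ram)
prime and `3 ∤ ∏c_ℓ(E)` — from PUBLISHED theorems and that ONE certificate (no Heegner index, no
partner curve, no Cassels–Tate). EVIDENCE pointer (lane data, nothing booked here): the x11b gen-9 /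
rmap-3 g5 rows `397848o1 @ 3`, `443400c1 @ 3` (atom A1, `surj(3)`, `#Ш_an = 9`, `#Sel₃ = 27` EXACT,
"every Heegner field of record has `ord₃ I_K = 2`") have exactly this shape. Per pair; label unchanged.
[cite: McCallumLMS1991, §1 Theorem (Kolyvagin), p. 296] [cite: Skinner2016PacificMC, Thm. C (§1) and footnote 1]
[cite: SilvermanAEC2009, Thm. X.4.2(a)] [cite: Miller2011LMS, §1 and Def. 1.1] -/
theorem IsX11Three.bsdp_of_ram_of_not_dvd_of_card_selmerThree_eq
    -- published inputs (named facts of the tree)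
    (hGZ : ∀ (N : ℕ) [NeZero N] (W : WeierstrassCurve ℚ) (K : Type) [Field K] [NumberField K],
      gross_zagier N W K)
    (hKo : ∀ (N : ℕ) [NeZero N] (W : WeierstrassCurve ℚ) (K : Type) [Field K] [NumberField K],
      kolyvagin N W K)
    (hB : ∀ (N : ℕ) [NeZero N] (W : WeierstrassCurve ℚ) (K : Type) [Field K] [NumberField K],
      Kolyvagin1990_padicValNat_card_sha_le N W K)
    (hSk : Skinner2016.thmC_padicValRat_bsd_rank_zero)
    (hGZK : rank_eq_analyticRank_of_analyticRank_le_one) (hmod : hasEntireLFunction_rat)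
    (hnf : exists_isNewformOf) (hHL : HoffsteinLuo1997_exists_twist_L_one_ne_zero)
    (hMaz : mazur_not_dvd_maninConstant_of_odd) (hNS : integral_neronScaling_of_isGloballyMinimal)
    (W : WeierstrassCurve ℚ) [W.IsElliptic] [W.IsGloballyMinimal] (hX : IsX11Three W)
    (hram : Ram W 3) (htam0 : ¬ 3 ∣ W.tamagawaProduct)
    (hcard : Nat.card (W.selmerGroup (3 : ℤ)) = 27) {s : ℚ} (hs : shaAn W = (s : ℂ))
    (hv : padicValRat 3 s ≤ 2) : BSDp W 3 :=
  IsX11Three.bsdp_of_ram_of_not_dvd_of_card_selmerThree hGZ hKo hB hSk hGZK hmod hnf hHL hMaz hNS W hX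
    hram htam0 (j := 2) (by rw [hcard]; norm_num) hs (by exact_mod_cast hv)

/-- **The same in the vocabulary of the typed class `ClassX11 W 3`** (`mult(3) ∧ irr(3) ∧ …`,
`Rank1Residual/X11.lean`) at analytic rank one, as in `X11.bsdp_three_of_cha_of_card_selmerThree`
(`SelmerRankOne.lean`) but with the Cha/Kolyvagin index certificate REPLACED by the atom condition
(ram) ∧ `3 ∤ ∏c_ℓ`: `#Sel^(3)(E/ℚ) = 3^(1+j)`, `ord_3 #Ш(E)_an ≤ j` ⇒ `BSD(E,3)`. Per pair; nothing
booked; X11 ∧ `r = 1` ∧ `p = 3` stays CONSTRUCTION-SHAPED.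
[cite: McCallumLMS1991, §1 Theorem (Kolyvagin), p. 296] [cite: Skinner2016PacificMC, Thm. C (§1) and footnote 1]
[cite: SilvermanAEC2009, Thm. X.4.2(a)] [cite: Miller2011LMS, §1 and Def. 1.1] -/
theorem X11.bsdp_three_of_ram_of_not_dvd_of_card_selmerThree
    -- published inputs (named facts of the tree)
    (hGZ : ∀ (N : ℕ) [NeZero N] (W : WeierstrassCurve ℚ) (K : Type) [Field K] [NumberField K],
      gross_zagier N W K)
    (hKo : ∀ (N : ℕ) [NeZero N] (W : WeierstrassCurve ℚ) (K : Type) [Field K] [NumberField K],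
      kolyvagin N W K)
    (hB : ∀ (N : ℕ) [NeZero N] (W : WeierstrassCurve ℚ) (K : Type) [Field K] [NumberField K],
      Kolyvagin1990_padicValNat_card_sha_le N W K)
    (hSk : Skinner2016.thmC_padicValRat_bsd_rank_zero)
    (hGZK : rank_eq_analyticRank_of_analyticRank_le_one) (hmod : hasEntireLFunction_rat)
    (hnf : exists_isNewformOf) (hHL : HoffsteinLuo1997_exists_twist_L_one_ne_zero)
    (hMaz : mazur_not_dvd_maninConstant_of_odd) (hNS : integral_neronScaling_of_isGloballyMinimal)
    (W : WeierstrassCurve ℚ) [W.IsElliptic] [W.IsGloballyMinimal] (hX : ClassX11 W 3)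
    (hr : W.analyticRank = 1) (hram : Ram W 3) (htam0 : ¬ 3 ∣ W.tamagawaProduct)
    {j : ℕ} (hcard : Nat.card (W.selmerGroup (3 : ℤ)) = 3 ^ (1 + j)) {s : ℚ}
    (hs : shaAn W = (s : ℂ)) (hv : padicValRat 3 s ≤ j) : BSDp W 3 :=
  IsX11Three.bsdp_of_ram_of_not_dvd_of_card_selmerThree hGZ hKo hB hSk hGZK hmod hnf hHL hMaz hNS W
    ⟨hX.1, hX.2.1, hr⟩ hram htam0 hcard hs hv

end Three

end Summit.BirchSwinnertonDyer.Rank1Residual.X11b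

end
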